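import Summits.Ventures.DiscreteObjects.PP12.NoPlanarOrderThree

/-!
# Baer 1946: a collineation with at least `n` fixed points leaves no point off its fixed lines (kernel, general order)
Framing: lottery ticket; floor = certified bounds/negative ranges.

REPLICATION of a classical lemma (R. Baer 1946; the argument is reproduced as the proof of Dembowski, *Finite Geometries* (1968),
§4.1 result 7, '`f(φ) ≥ n` implies `φ` quasicentral'): for a collineation `σ` of a finite projective plane of order `n` with at least
`n` fixed points, every non-fixed point lies on a fixed line (`mem_fixedLine_of_order_le_card_fixed`); in particular `σ` does not
have exactly `n` fixed points unless every point is covered by the fixed lines. This sharpens `mem_fixedLine_of_card_fixed`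
(`NoPlanarOrderThreeCensus`, hypothesis `n + 1 ≤ f`) by one. Proof (Baer): if `w` lies on no fixed line, the lines `wx` (`x` fixed)
are `≥ n` distinct lines through `w`, so at most one line through `w` misses all fixed points; the same holds at `σw`; the line
`w·σw` misses all fixed points (a fixed point on it would make it fixed), and so does its image `σw·σ²w`; both pass through `σw`,
hence they coincide, i.e. `w·σw` is fixed — contradiction. Cell pub-namedobj (target M), designs g10; no `sorry`, no new axioms.
-/

namespace Summit.Ventures.DiscreteObjects.PP12

open Configuration Finset
open scoped Classical

namespace Collineation

variable {P L : Type*} [Membership P L] [ProjectivePlane P L] [Fintype P] [Fintype L]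
  [DecidableEq P] [DecidableEq L] (σ : Collineation P L)

/-- If `σ` has at least `n` fixed points and `W` lies on no fixed line, then any two lines through `W` that carry no fixed point
coincide (the lines `Wx`, `x` fixed, already account for `≥ n` of the `n + 1` lines through `W`). -/
theorem eq_of_no_fixed_point (hf : ProjectivePlane.order P L ≤ fixedCard σ.onPoints) {W : P}
    (hW : ∀ l : L, σ.onLines l = l → W ∉ l) {m m' : L} (hWm : W ∈ m) (hWm' : W ∈ m')
    (hm : ∀ x : P, σ.onPoints x = x → x ∉ m) (hm' : ∀ x : P, σ.onPoints x = x → x ∉ m') : m = m' := by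
  set S : Finset P := univ.filter fun x : P => σ.onPoints x = x with hS
  have hScard : ProjectivePlane.order P L ≤ S.card := hf
  set LW : Finset L := univ.filter fun l : L => W ∈ l with hLW
  have hLWcard : LW.card = ProjectivePlane.order P L + 1 := by
    rw [hLW, ← Fintype.card_subtype, ← Nat.card_eq_fintype_card]
    exact ProjectivePlane.lineCount_eq L W
  -- W is not fixed (a fixed W lies on the fixed line through W and any other fixed point... we only need W ≠ x for x fixed)
  have hWne : ∀ x ∈ S, W ≠ x := by
    intro x hx e
    have fx : σ.onPoints x = x := by simpa [hS] using hx
    -- W = x fixed: then the line m through W contains the fixed point x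
    exact hm x fx (e ▸ hWm)
  haveI : Nonempty L := ⟨m⟩
  let g : P → L := fun x => if h : W ≠ x then HasLines.mkLine h else m
  have hg : ∀ x ∈ S, W ∈ g x ∧ x ∈ g x := fun x hx => by
    simp only [g, dif_pos (hWne x hx)]; exact HasLines.mkLine_ax (hWne x hx)
  have hmaps : ∀ x ∈ S, g x ∈ LW := fun x hx => by simp [hLW, (hg x hx).1]
  have hinj : Set.InjOn g S := by
    intro x hx x' hx' heq
    by_contra hxx'
    have fx : σ.onPoints x = x := by simpa [hS] using hx
    have fx' : σ.onPoints x' = x' := by simpa [hS] using hx'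
    have h1 := hg x hx
    have h2 := hg x' hx'
    rw [← heq] at h2
    exact hW (g x) (σ.line_fixed_of_two_fixed h1.2 h2.2 hxx' fx fx') h1.1
  -- m and m' are lines through W outside the image of g
  have hm_notin : m ∉ S.image g := by
    intro h
    obtain ⟨x, hx, hxm⟩ := Finset.mem_image.mp h
    have fx : σ.onPoints x = x := by simpa [hS] using hx
    exact hm x fx (hxm ▸ (hg x hx).2)
  have hm'_notin : m' ∉ S.image g := by
    intro h
    obtain ⟨x, hx, hxm⟩ := Finset.mem_image.mp h
    have fx : σ.onPoints x = x := by simpa [hS] using hx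
    exact hm' x fx (hxm ▸ (hg x hx).2)
  have hsub : S.image g ⊆ LW := fun l hl => by
    obtain ⟨x, hx, rfl⟩ := Finset.mem_image.mp hl; exact hmaps x hx
  have himg : ProjectivePlane.order P L ≤ (S.image g).card := by
    rw [Finset.card_image_of_injOn hinj]; exact hScard
  -- the complement of the image inside LW has at most one element
  have hcompl : (LW \ S.image g).card ≤ 1 := by
    rw [Finset.card_sdiff_of_subset hsub, hLWcard]; omega
  have hmC : m ∈ LW \ S.image g := Finset.mem_sdiff.mpr ⟨by simp [hLW, hWm], hm_notin⟩
  have hm'C : m' ∈ LW \ S.image g := Finset.mem_sdiff.mpr ⟨by simp [hLW, hWm'], hm'_notin⟩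
  exact Finset.card_le_one.mp hcompl m hmC m' hm'C

/-- **Baer 1946 (Dembowski 4.1.7).** A collineation of a plane of order `n` with at least `n` fixed points leaves no point off its
fixed lines: every non-fixed point lies on a fixed line. -/
theorem mem_fixedLine_of_order_le_card_fixed (hf : ProjectivePlane.order P L ≤ fixedCard σ.onPoints) {Q : P}
    (hQ : σ.onPoints Q ≠ Q) : ∃ l : L, σ.onLines l = l ∧ Q ∈ l := by
  by_contra hcon
  push Not at hcon
  have hQX : σ.onPoints Q ≠ Q ∧ ∀ l : L, σ.onLines l = l → Q ∉ l := ⟨hQ, hcon⟩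
  have hQ1X := σ.map_exterior hQX            -- σQ is exterior as well
  -- the line m = Q·σQ and its image σ m = σQ·σ²Q
  set m : L := HasLines.mkLine hQ.symm with hm
  have hQm : Q ∈ m := (HasLines.mkLine_ax hQ.symm).1
  have hσQm : σ.onPoints Q ∈ m := (HasLines.mkLine_ax hQ.symm).2
  have hσQm' : σ.onPoints Q ∈ σ.onLines m := σ.mem_map hQm
  -- neither carries a fixed point
  have hm0 : ∀ x : P, σ.onPoints x = x → x ∉ m := fun x fx hxm =>
    σ.map_not_mem_of_exterior fx hQX hxm hQm hσQm
  have hm1 : ∀ x : P, σ.onPoints x = x → x ∉ σ.onLines m := by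
    intro x fx hx
    have hxm : x ∈ m := (σ.mem_iff x m).1 (by rw [fx]; exact hx)
    exact hm0 x fx hxm
  -- both pass through σQ, which lies on no fixed line: they coincide, so m is fixed
  have heq : m = σ.onLines m := σ.eq_of_no_fixed_point hf hQ1X.2 hσQm hσQm' hm0 hm1
  exact hcon m heq.symm hQm

/-- Consequence (Dembowski 4.1 (2)): under the same hypothesis every point lies on a fixed line or is fixed; e.g. on a plane of
order 12 a collineation with at least 12 fixed points covers the whole plane by its fixed lines. -/
theorem fixed_or_mem_fixedLine (hf : ProjectivePlane.order P L ≤ fixedCard σ.onPoints) (Q : P) :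
    σ.onPoints Q = Q ∨ ∃ l : L, σ.onLines l = l ∧ Q ∈ l := by
  by_cases h : σ.onPoints Q = Q
  · exact Or.inl h
  · exact Or.inr (σ.mem_fixedLine_of_order_le_card_fixed hf h)

end Collineation

end Summit.Ventures.DiscreteObjects.PP12
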